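import Literature.Probability.Percolation.FourArmGarbanProofs
import Literature.Probability.Percolation.AnnulusCircuitsProofs
import HarnessLib

/-!
# Six arms from five arms, I: no winding circuit through two separated crossing clusters and a
third cluster's boundary (support file for the stub `stub_sixArm_of_fiveArm`)

Serves the registered stub `stub_sixArm_of_fiveArm` of crux stmt-CriticalPhenomena-10268 (line
`hitting-tournament`; K3 of the kernel package: the whole-plane alternating six-arm bound with
exponent `2 + ε` for critical bond percolation on `ℤ²`, REDUCED to the two-radii five-arm upper
bound).  The reduction is Reimer's inequality `𝒜₆ ⊆ 𝒜₅ □ 𝒟` with `𝒟` a decreasing "no open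
circuit" event, and the only planar-topological input is the deterministic statement of this file:

* `sixArmOfFiveArm_walkWinding_eq_zero` — let `ω` be a lattice configuration, `A = A_{m,n}` the
  square annulus (`1 ≤ m`), `x₁ ↔ y₁`, `x₂ ↔ y₂` two open crossings of `A` (from `‖·‖_∞ = m` to
  `‖·‖_∞ = n`) whose clusters in `A` are distinct, and `𝒞₃ = {v | x₃ ↔ v in A}` a third open
  cluster of `A`, distinct from both.  Then EVERY closed lattice walk of `A` each of whose edges is
  either open or has an endpoint in `𝒞₃` has winding number `0` about the face `[0,1]²`
  (`walkWinding · 0`, `PlanarDuality.lean`).  In words: opening all closed edges at the boundary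
  of the third cluster creates no open circuit around the hole — the complement of that boundary
  among the closed edges still blocks every circuit, which is what makes the sixth (dual) arm a
  witness DISJOINT from the five-arm witness.

Proof (purely combinatorial given the tree's crossing lemma
`exists_mem_support_inter_of_enclosesOrigin` and `enclosesOrigin_of_walkWinding_ne_zero`): a closed
walk of `A` with non-zero winding meets both crossings, at vertices `z₁`, `z₂` not joined inside
`A` (`sixArmOfFiveArm_meets_of_walkWinding_ne_zero`).  By induction on the length
(`sixArmOfFiveArm_walkWinding_eq_aux`), a walk `γ` as above between two points of `𝒞₃` has the same
winding as any walk inside `𝒞₃` between them: peel an initial vertex in `𝒞₃`, or an initial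
excursion `a → a' ⋯ w → c` off `𝒞₃` up to its first return `c ∈ 𝒞₃` (its interior edges join
non-`𝒞₃` vertices, hence are open, so its interior is one open piece; closing it up through `𝒞₃`
gives a closed walk whose vertices off `𝒞₃` are pairwise joined — so its winding vanishes).  A
closed `γ` through `𝒞₃` is thus null-winding, and one avoiding `𝒞₃` is open, hence null-winding by
the same crossing argument (`sixArmOfFiveArm_walkWinding_eq_zero_aux`).

References: H. Kesten, *Percolation theory for mathematicians* (1982), §2.2–2.3 (lattice
separation); P. Nolin, Electron. J. Probab. 13 (2008), §4 (arm events, Reimer for non-monotone arm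
events); D. Reimer, Combin. Probab. Comput. 9 (2000).
-/

noncomputable section

open Set SimpleGraph
open Literature.Probability.Percolation Literature.Probability.LatticeModels

namespace Summit.CriticalPhenomena.CardyFormulaZ2.Cruxes.LagHandOff.HittingTournament

/-! ### Walk surgery -/

/-- **First-hit decomposition.**  A walk from a vertex where `P` fails to a vertex where `P` holds
splits as `q₀ ++ (w → w') ++ q₁` with `P` failing on all of `q₀` and holding at `w'` (the first
vertex of the walk satisfying `P`). -/
theorem sixArmOfFiveArm_exists_firstHit_split {V : Type*} {G : SimpleGraph V} (P : V → Prop) :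
    ∀ {u v : V} (p : G.Walk u v), ¬ P u → P v →
      ∃ (w w' : V) (q₀ : G.Walk u w) (h : G.Adj w w') (q₁ : G.Walk w' v),
        p = q₀.append (Walk.cons h q₁) ∧ (∀ z ∈ q₀.support, ¬ P z) ∧ P w' := by
  intro u v p
  induction p with
  | nil => intro hu hv; exact absurd hv hu
  | @cons a b c h p ih =>
    intro ha hc
    by_cases hb : P b
    · exact ⟨a, b, Walk.nil, h, p, by simp, by simpa using ha, hb⟩
    · obtain ⟨w, w', q₀, h', q₁, hp, hq₀, hw'⟩ := ih hb hc
      refine ⟨w, w', Walk.cons h q₀, h', q₁, by rw [hp]; rfl, ?_, hw'⟩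
      intro z hz
      rw [Walk.support_cons, List.mem_cons] at hz
      rcases hz with rfl | hz
      · exact ha
      · exact hq₀ z hz

/-- The winding number of a rotated closed walk equals that of the walk (the darts are rotated). -/
theorem sixArmOfFiveArm_walkWinding_rotate {a z : Site 2} (γ : (zdGraph 2).Walk a a)
    (hz : z ∈ γ.support) (u : Site 2) : walkWinding (γ.rotate z hz) u = walkWinding γ u := by
  unfold walkWinding
  exact ((Walk.rotate_darts γ z hz).perm.map _).sum_eq

/-! ### A closed walk with non-zero winding meets every crossing -/

/-- The origin is off the planar trace of a walk of the annulus `A_{m,n}`, `1 ≤ m`. -/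
theorem sixArmOfFiveArm_zero_not_mem_walkTrace {m n : ℕ} (hm : 1 ≤ m) {a b : Site 2}
    (C : (zdGraph 2).Walk a b) (hC : ∀ z ∈ C.support, z ∈ sqAnnulus m n) :
    (0 : ℂ) ∉ walkTrace C := by
  intro h0
  obtain ⟨e, he, h0e⟩ := mem_walkTrace_iff.1 h0
  obtain ⟨-, k, hk'⟩ := coordVec_bounds_of_mem_edgeTrace hm (C.edges_subset_edgeSet he)
    (fun x hx => hC x (C.mem_support_of_mem_edges he hx)) h0e
  have hnorm := abs_coordVec_le_norm (0 : ℂ) k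
  rw [norm_zero] at hnorm
  have ha1 : (1 : ℝ) ≤ m := by exact_mod_cast hm
  rcases hk' with hk' | hk'
  · linarith [le_abs_self (coordVec 0 k)]
  · linarith [neg_abs_le (coordVec 0 k)]

/-- **A closed walk of `A_{m,n}` with non-zero winding number meets every crossing of `A_{m,n}`**
(`1 ≤ m`): non-zero winding at the face `[0,1]²` makes it enclose the origin
(`enclosesOrigin_of_walkWinding_ne_zero`), and an enclosing walk of the annulus meets every walk
of the annulus from `‖·‖_∞ = m` to `‖·‖_∞ = n` (`exists_mem_support_inter_of_enclosesOrigin`). -/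
theorem sixArmOfFiveArm_meets_of_walkWinding_ne_zero {m n : ℕ} (hm : 1 ≤ m) {a : Site 2}
    (C : (zdGraph 2).Walk a a) (hC : ∀ z ∈ C.support, z ∈ sqAnnulus m n)
    (hW : walkWinding C 0 ≠ 0) {x y : Site 2} (hx : x ∈ siteSphere m) (hy : y ∈ siteSphere n)
    (p : (zdGraph 2).Walk x y) (hp : ∀ z ∈ p.support, z ∈ sqAnnulus m n) :
    ∃ z, z ∈ p.support ∧ z ∈ C.support :=
  exists_mem_support_inter_of_enclosesOrigin hm hC
    (enclosesOrigin_of_walkWinding_ne_zero C (sixArmOfFiveArm_zero_not_mem_walkTrace hm C hC) hW)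
    hx hy p hp

/-! ### The induction: winding of walks with open-or-boundary edges -/

/-- A closed walk inside `C₃` has winding `0`, given the abstract crossing property `hA`: every
closed walk of `S` with non-zero winding has two vertices OFF `C₃` not joined inside `S`. -/
theorem sixArmOfFiveArm_walkWinding_eq_zero_of_subset {S C₃ : Set (Site 2)}
    {ω : BondConfig (Site 2)} (hC₃S : C₃ ⊆ S)
    (hA : ∀ {a : Site 2} (l : (zdGraph 2).Walk a a), (∀ z ∈ l.support, z ∈ S) →
      walkWinding l 0 ≠ 0 → ∃ z₁ ∈ l.support, ∃ z₂ ∈ l.support,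
        z₁ ∉ C₃ ∧ z₂ ∉ C₃ ∧ ω ∉ openConnIn S z₁ z₂)
    {a : Site 2} (π : (zdGraph 2).Walk a a) (hπ : ∀ z ∈ π.support, z ∈ C₃) :
    walkWinding π 0 = 0 := by
  by_contra hne
  obtain ⟨z₁, hz₁, _, _, hz₁C, -, -⟩ := hA π (fun z hz => hC₃S (hπ z hz)) hne
  exact hz₁C (hπ z₁ hz₁)

/-- **The induction.**  Let `C₃ ⊆ S` be "connected" (any two of its points are joined by a lattice
walk inside `C₃`) and assume the crossing property `hA`.  Then a lattice walk `γ` of `S` between two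
points of `C₃`, each of whose edges is open in `ω` or has an endpoint in `C₃`, has the same winding
number as every walk inside `C₃` with the same endpoints.  (Induction on the length: peel a first
step landing in `C₃`, or a first excursion off `C₃`; the excursion's interior is an open piece of
`S`, so closing it up through `C₃` yields a closed walk all of whose off-`C₃` vertices are joined in
`S`, which by `hA` has winding `0`.) -/
theorem sixArmOfFiveArm_walkWinding_eq_aux {S C₃ : Set (Site 2)} {ω : BondConfig (Site 2)}
    (hconn : ∀ u ∈ C₃, ∀ v ∈ C₃, ∃ ρ : (zdGraph 2).Walk u v, ∀ z ∈ ρ.support, z ∈ C₃)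
    (hC₃S : C₃ ⊆ S)
    (hA : ∀ {a : Site 2} (l : (zdGraph 2).Walk a a), (∀ z ∈ l.support, z ∈ S) →
      walkWinding l 0 ≠ 0 → ∃ z₁ ∈ l.support, ∃ z₂ ∈ l.support,
        z₁ ∉ C₃ ∧ z₂ ∉ C₃ ∧ ω ∉ openConnIn S z₁ z₂) :
    ∀ (N : ℕ) {a b : Site 2} (γ : (zdGraph 2).Walk a b), γ.length ≤ N →
      (∀ z ∈ γ.support, z ∈ S) → (∀ e ∈ γ.edges, e ∈ ω ∨ ∃ v ∈ e, v ∈ C₃) →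
      a ∈ C₃ → b ∈ C₃ → ∀ π : (zdGraph 2).Walk a b, (∀ z ∈ π.support, z ∈ C₃) →
        walkWinding γ 0 = walkWinding π 0 := by
  classical
  intro N
  induction N with
  | zero =>
    intro a b γ hlen hγS hγe ha hb π hπ
    cases γ with
    | nil =>
      rw [walkWinding_nil]
      exact (sixArmOfFiveArm_walkWinding_eq_zero_of_subset hC₃S hA π hπ).symm
    | cons h γ' => simp at hlen
  | succ N ih =>
    intro a b γ hlen hγS hγe ha hb π hπ
    cases γ with
    | nil =>
      rw [walkWinding_nil]
      exact (sixArmOfFiveArm_walkWinding_eq_zero_of_subset hC₃S hA π hπ).symm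
    | @cons _ a' _ h γ' =>
      rw [Walk.length_cons] at hlen
      have hlen' : γ'.length ≤ N := by omega
      have hγ'S : ∀ z ∈ γ'.support, z ∈ S := fun z hz =>
        hγS z (by rw [Walk.support_cons]; exact List.mem_cons_of_mem _ hz)
      have hγ'e : ∀ e ∈ γ'.edges, e ∈ ω ∨ ∃ v ∈ e, v ∈ C₃ := fun e he =>
        hγe e (by rw [Walk.edges_cons]; exact List.mem_cons_of_mem _ he)
      rw [walkWinding_cons]
      by_cases ha' : a' ∈ C₃
      · -- first step lands in `C₃`
        have hπ' : ∀ z ∈ (Walk.cons h.symm π).support, z ∈ C₃ := by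
          intro z hz
          rw [Walk.support_cons, List.mem_cons] at hz
          rcases hz with rfl | hz
          · exact ha'
          · exact hπ z hz
        have := ih γ' hlen' hγ'S hγ'e ha' hb (Walk.cons h.symm π) hπ'
        rw [walkWinding_cons, stepWinding_antisymm] at this
        linarith
      · -- first excursion off `C₃`, up to the first return `c ∈ C₃`
        obtain ⟨w, c, q₀, h', q₁, hsplit, hq₀, hc⟩ :=
          sixArmOfFiveArm_exists_firstHit_split (· ∈ C₃) γ' ha' hb
        subst hsplit
        have hq₁len : q₁.length ≤ N := by
          rw [Walk.length_append, Walk.length_cons] at hlen'; omega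
        have hq₀S : ∀ z ∈ q₀.support, z ∈ S := fun z hz =>
          hγ'S z ((Walk.mem_support_append_iff _ _).2 (Or.inl hz))
        have hq₁S : ∀ z ∈ q₁.support, z ∈ S := fun z hz =>
          hγ'S z ((Walk.mem_support_append_iff _ _).2
            (Or.inr (by rw [Walk.support_cons]; exact List.mem_cons_of_mem _ hz)))
        have hq₀e : ∀ e ∈ q₀.edges, e ∈ ω := by
          intro e he
          have he' : e ∈ (q₀.append (Walk.cons h' q₁)).edges := by
            rw [Walk.edges_append]; exact List.mem_append_left _ he
          rcases hγ'e e he' with h1 | ⟨v, hv, hvC⟩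
          · exact h1
          · exact absurd hvC (hq₀ v (q₀.mem_support_of_mem_edges he hv))
        have hq₁e : ∀ e ∈ q₁.edges, e ∈ ω ∨ ∃ v ∈ e, v ∈ C₃ := fun e he =>
          hγ'e e (by
            rw [Walk.edges_append, Walk.edges_cons]
            exact List.mem_append_right _ (List.mem_cons_of_mem _ he))
        -- a walk inside `C₃` from `c` back to `a`
        obtain ⟨ρ, hρ⟩ := hconn c hc a ha
        -- induction hypothesis for the tail `q₁`
        have hρπ : ∀ z ∈ (ρ.append π).support, z ∈ C₃ := by
          intro z hz
          rcases (Walk.mem_support_append_iff _ _).1 hz with hz | hz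
          · exact hρ z hz
          · exact hπ z hz
        have IH₁ := ih q₁ hq₁len hq₁S hq₁e hc hb (ρ.append π) hρπ
        rw [walkWinding_append] at IH₁
        -- the closed walk `a → a' ⋯ w → c ⋯ a` has winding `0`
        set μ : (zdGraph 2).Walk a c := Walk.cons h (q₀.append (Walk.cons h' Walk.nil)) with hμ
        have hμS : ∀ z ∈ μ.support, z ∈ S := by
          intro z hz
          rw [hμ, Walk.support_cons, List.mem_cons] at hz
          rcases hz with rfl | hz
          · exact hC₃S ha
          · rcases (Walk.mem_support_append_iff _ _).1 hz with hz | hz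
            · exact hq₀S z hz
            · rw [Walk.support_cons, Walk.support_nil, List.mem_cons, List.mem_singleton] at hz
              rcases hz with rfl | rfl
              · exact hq₀S _ q₀.end_mem_support
              · exact hC₃S hc
        have hμ0 : walkWinding (μ.append ρ) 0 = 0 := by
          by_contra hne
          obtain ⟨z₁, hz₁, z₂, hz₂, hz₁C, hz₂C, hnc⟩ := hA (μ.append ρ) (by
            intro z hz
            rcases (Walk.mem_support_append_iff _ _).1 hz with hz | hz
            · exact hμS z hz
            · exact hC₃S (hρ z hz)) hne
          -- both vertices lie on the excursion `q₀`
          have key : ∀ z ∈ (μ.append ρ).support, z ∉ C₃ → z ∈ q₀.support := by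
            intro z hz hzC
            rcases (Walk.mem_support_append_iff _ _).1 hz with hz | hz
            · rw [hμ, Walk.support_cons, List.mem_cons] at hz
              rcases hz with rfl | hz
              · exact absurd ha hzC
              · rcases (Walk.mem_support_append_iff _ _).1 hz with hz | hz
                · exact hz
                · rw [Walk.support_cons, Walk.support_nil, List.mem_cons, List.mem_singleton] at hz
                  rcases hz with rfl | rfl
                  · exact q₀.end_mem_support
                  · exact absurd hc hzC
            · exact absurd (hρ z hz) hzC
          obtain ⟨r, hre, hrs⟩ := exists_subwalk q₀ (key z₁ hz₁ hz₁C) (key z₂ hz₂ hz₂C)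
          exact hnc (mem_openConnIn_of_walk r (fun z hz => hq₀S z (hrs z hz))
            (fun e he => hq₀e e (hre e he)))
        rw [walkWinding_append, hμ, walkWinding_cons, walkWinding_append, walkWinding_cons,
          walkWinding_nil] at hμ0
        rw [walkWinding_append, walkWinding_cons, IH₁]
        linarith

/-- **Closed walks with open-or-boundary edges have winding `0`** (abstract form): under the
hypotheses of `sixArmOfFiveArm_walkWinding_eq_aux`, every closed walk of `S` each of whose edges is
open or has an endpoint in `C₃` has winding number `0` about `[0,1]²`: if it visits `C₃`, rotate it
to start there and compare with the trivial walk; otherwise all its edges are open, it is one open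
piece of `S`, and `hA` applies directly. -/
theorem sixArmOfFiveArm_walkWinding_eq_zero_aux {S C₃ : Set (Site 2)} {ω : BondConfig (Site 2)}
    (hconn : ∀ u ∈ C₃, ∀ v ∈ C₃, ∃ ρ : (zdGraph 2).Walk u v, ∀ z ∈ ρ.support, z ∈ C₃)
    (hC₃S : C₃ ⊆ S)
    (hA : ∀ {a : Site 2} (l : (zdGraph 2).Walk a a), (∀ z ∈ l.support, z ∈ S) →
      walkWinding l 0 ≠ 0 → ∃ z₁ ∈ l.support, ∃ z₂ ∈ l.support,
        z₁ ∉ C₃ ∧ z₂ ∉ C₃ ∧ ω ∉ openConnIn S z₁ z₂)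
    {a : Site 2} (γ : (zdGraph 2).Walk a a) (hγS : ∀ z ∈ γ.support, z ∈ S)
    (hγe : ∀ e ∈ γ.edges, e ∈ ω ∨ ∃ v ∈ e, v ∈ C₃) : walkWinding γ 0 = 0 := by
  classical
  by_cases hex : ∃ z ∈ γ.support, z ∈ C₃
  · obtain ⟨z, hz, hzC⟩ := hex
    rw [← sixArmOfFiveArm_walkWinding_rotate γ hz 0]
    have h := sixArmOfFiveArm_walkWinding_eq_aux hconn hC₃S hA (γ.rotate z hz).length
      (γ.rotate z hz) le_rfl
      (fun w hw => hγS w ((Walk.mem_support_rotate_iff γ z hz).1 hw))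
      (fun e he => hγe e ((Walk.rotate_edges γ z hz).mem_iff.1 he)) hzC hzC Walk.nil
      (by intro w hw; rw [Walk.support_nil, List.mem_singleton] at hw; rw [hw]; exact hzC)
    rwa [walkWinding_nil] at h
  · push Not at hex
    have hopen : ∀ e ∈ γ.edges, e ∈ ω := fun e he => (hγe e he).elim id
      fun ⟨v, hv, hvC⟩ => absurd hvC (hex v (γ.mem_support_of_mem_edges he hv))
    by_contra hne
    obtain ⟨z₁, hz₁, z₂, hz₂, -, -, hnc⟩ := hA γ hγS hne
    obtain ⟨r, hre, hrs⟩ := exists_subwalk γ hz₁ hz₂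
    exact hnc (mem_openConnIn_of_walk r (fun z hz => hγS z (hrs z hz))
      (fun e he => hopen e (hre e he)))

/-! ### The concrete statement: two separated crossing clusters and a third cluster -/

/-- **No winding circuit through two separated crossings and a third cluster's boundary.**  Let
`ω ⊆ E(ℤ²)`, `1 ≤ m`, `x₁ ↔ y₁` and `x₂ ↔ y₂` open in `A_{m,n}` with `‖xᵢ‖_∞ = m`, `‖yᵢ‖_∞ = n`,
`x₁ ↮ x₂` in `A_{m,n}`, and let `x₃` be joined inside `A_{m,n}` neither to `x₁` nor to `x₂`.  Then
every closed lattice walk of `A_{m,n}` each of whose edges is open OR has an endpoint joined to `x₃`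
inside `A_{m,n}` has winding number `0` about the face `[0,1]²`.  (Crossing property: a closed walk
of non-zero winding meets both crossings, at vertices off the cluster of `x₃` and not joined in the
annulus; connectivity of the cluster of `x₃` through open walks of the annulus.) -/
theorem sixArmOfFiveArm_walkWinding_eq_zero : ∀ {m n : ℕ}, 1 ≤ m → ∀ {ω : BondConfig (Site 2)},
    ω ⊆ (zdGraph 2).edgeSet → ∀ {x₁ y₁ x₂ y₂ x₃ : Site 2}, x₁ ∈ siteSphere m → y₁ ∈ siteSphere n →
    x₂ ∈ siteSphere m → y₂ ∈ siteSphere n → ω ∈ openConnIn (sqAnnulus m n) x₁ y₁ →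
    ω ∈ openConnIn (sqAnnulus m n) x₂ y₂ → ω ∉ openConnIn (sqAnnulus m n) x₁ x₂ →
    ω ∉ openConnIn (sqAnnulus m n) x₃ x₁ → ω ∉ openConnIn (sqAnnulus m n) x₃ x₂ →
    ∀ {a : Site 2} (γ : (zdGraph 2).Walk a a), (∀ z ∈ γ.support, z ∈ sqAnnulus m n) →
    (∀ e ∈ γ.edges, e ∈ ω ∨ ∃ v ∈ e, ω ∈ openConnIn (sqAnnulus m n) x₃ v) →
    walkWinding γ 0 = 0 := by
  classical
  intro m n hm ω hω x₁ y₁ x₂ y₂ x₃ hx₁ hy₁ hx₂ hy₂ h₁ h₂ h₁₂ h₃₁ h₃₂ a γ hγS hγe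
  set S : Set (Site 2) := sqAnnulus m n with hS
  set C₃ : Set (Site 2) := {v | ω ∈ openConnIn S x₃ v} with hC₃
  have hC₃S : C₃ ⊆ S := fun v hv => by obtain ⟨-, hv, -⟩ := hv; exact hv
  -- connectivity of `C₃` through walks inside `C₃`
  have hconn : ∀ u ∈ C₃, ∀ v ∈ C₃, ∃ ρ : (zdGraph 2).Walk u v, ∀ z ∈ ρ.support, z ∈ C₃ := by
    intro u hu v hv
    have huv : ω ∈ openConnIn S u v := by
      have hu' : ω ∈ openConnIn S u x₃ := by rw [openConnIn_comm]; exact hu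
      exact PlanarDuality.openConnIn_trans hu' hv
    obtain ⟨ρ, hρS, hρe⟩ := exists_walk_of_mem_openConnIn hω huv
    exact ⟨ρ, fun z hz =>
      PlanarDuality.openConnIn_trans hu (mem_openConnIn_of_mem_support ρ hρS hρe hz)⟩
  -- the two crossings as walks
  obtain ⟨W₁, hW₁S, hW₁e⟩ := exists_walk_of_mem_openConnIn hω h₁
  obtain ⟨W₂, hW₂S, hW₂e⟩ := exists_walk_of_mem_openConnIn hω h₂
  -- the crossing property
  have hA : ∀ {a : Site 2} (l : (zdGraph 2).Walk a a), (∀ z ∈ l.support, z ∈ S) →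
      walkWinding l 0 ≠ 0 → ∃ z₁ ∈ l.support, ∃ z₂ ∈ l.support,
        z₁ ∉ C₃ ∧ z₂ ∉ C₃ ∧ ω ∉ openConnIn S z₁ z₂ := by
    intro a l hlS hlW
    obtain ⟨z₁, hz₁W, hz₁l⟩ := sixArmOfFiveArm_meets_of_walkWinding_ne_zero hm l hlS hlW hx₁ hy₁ W₁ hW₁S
    obtain ⟨z₂, hz₂W, hz₂l⟩ := sixArmOfFiveArm_meets_of_walkWinding_ne_zero hm l hlS hlW hx₂ hy₂ W₂ hW₂S
    have hx₁z₁ : ω ∈ openConnIn S x₁ z₁ := mem_openConnIn_of_mem_support W₁ hW₁S hW₁e hz₁W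
    have hx₂z₂ : ω ∈ openConnIn S x₂ z₂ := mem_openConnIn_of_mem_support W₂ hW₂S hW₂e hz₂W
    refine ⟨z₁, hz₁l, z₂, hz₂l, fun hz₁C => h₃₁ ?_, fun hz₂C => h₃₂ ?_, fun h12 => h₁₂ ?_⟩
    · exact PlanarDuality.openConnIn_trans hz₁C (by rw [openConnIn_comm]; exact hx₁z₁)
    · exact PlanarDuality.openConnIn_trans hz₂C (by rw [openConnIn_comm]; exact hx₂z₂)
    · exact PlanarDuality.openConnIn_trans (PlanarDuality.openConnIn_trans hx₁z₁ h12)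
        (by rw [openConnIn_comm]; exact hx₂z₂)
  exact sixArmOfFiveArm_walkWinding_eq_zero_aux hconn hC₃S hA γ hγS hγe

end Summit.CriticalPhenomena.CardyFormulaZ2.Cruxes.LagHandOff.HittingTournament

end
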